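import Summits.QuantumFields.BalabanUV.Beta.FP.GhostJetReflection
import Summits.QuantumFields.BalabanUV.Beta.D1BFx.GhostStencilWard

/-!
# `BalabanUV.Beta.FP.GhostBiTableReflection` — road «FP» for binder row D1, sub-row H2-ASM-5a (Kcov), ghost half AT THE ADMISSIBLE CROSS CONTACT: leaf-02's
# `GhostJetReflection` §4–§5 (typed for the head contact `Wgh`, which FAILS (a8g) — `GhostBiTableLaw.not_hW2g_Wgh`) RE-READ VERBATIM at `w := diagExt (c • ghX)`,
# the table that SATISFIES (a8g) (`GhostBiTableLaw.hW2g_ghX`): the tadpole word of ANY bond-diagonal extension is reflection covariant, hence the ghost-sector Hessian kernel and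
# `PiBF`'s (Kcov) with the ghost sector at `(cV • ghCur, diagExt (c • ghX))` follow from the GLUON letters alone

HONEST DEPENDENCY (page 1, mandatory): continuum YM on T⁴ ⇐ BetaPertH ∧ nine spine estimates (0/9 proved); BetaPertH ⇐ (D1) ∧ (D4) ∧ CAP+tail;
G-an2-4 gates asym, D1 and NE2/3/4.  HONEST FRAMING (cell contract, verbatim): «discharging `BetaPertH` makes Bałaban's UV stability UNCONDITIONAL —
a real constructive-QFT result; it is NOT the continuum limit and NOT the Clay problem.»  THIS MODULE DISCHARGES NOTHING of the wall: it is leaf-02 g9's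
`GhostJetReflection.axisReflectionCovariant_flip_hessKer_ghost` ∕ `…_flipK_PiBF_ghostTyped` (CREDITED; proofs verbatim) with ONE table replaced; 0 def, 0 `def … : Prop`, nothing cited,
0 sorry; 0∕4 row-D1 binders.  NOT the gluon half of (Kcov) (its letters stay displayed), NOT hasym, NOT D1, NOT BetaPertH, NOT continuum, NOT Clay.  «not in print; our bookkeeping».

ABSOLUTE RULE (cell charter, verbatim): «No internally-minted statement may enter as a cited fact. Every hypothesis is either kernel-proved in this package or a
verbatim quotation of a PUBLISHED theorem with page reference. The manuscript(s) under audit are NOT citable for their own disputed steps — they are the thing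
under adjudication; programme-internal (2001/route/tribunal) claims are never citable.»

CONTENT: §1 [folklore] `diagExt_of_neg` (off the diagonal bond a diagonal extension is `0`), **`axisReflectionCovariant_flip_tadpoleKer_diagExt`** (any scalar leg, any one-bond
table); §2 [our object] **`axisReflectionCovariant_flip_hessKer_ghostX`** (`AxisReflectionCovariant (fun μ ν z => hessKer G0ker (cV • ghCur) (diagExt (c • ghX)) μ ν (−z))`,
UNCONDITIONAL, every real `cV c`) and **`axisReflectionCovariant_flipK_PiBF_ghostX`** ((Kcov) for `PiBF wg wgh V W (cV • ghCur) (diagExt (c • ghX))` from the GLUON letters alone —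
VERBATIM the hypothesis list of leaf-02's `…_ghostTyped`).
Provenance: D1 formalisation swarm LEAF PROVER 01, unit `b2b-balaban-beta-d1-formalise-leaf-01` gen 14, 2026-08-21; proofs = leaf-02 g9's (road FP engine lineage), credited.
-/

noncomputable section

namespace Summit.QuantumFields.BalabanUV.Beta.FP.GhostBiTableReflection

open Finset
open scoped BigOperators
open Literature.MathematicalPhysics.QuantumFieldTheory.Balaban1983to89
open Literature.MathematicalPhysics.QuantumFieldTheory.Balaban1983to89.Beta
open PolarizationSign (axisReflect axisReflect_apply reflSign AxisReflectionCovariant)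
open ExpKernelCalculus (MKer Site BiLoc comp tr bubble tadpole hessKer shiftK)
open OneStepResolventKernel (Fib)
open OneStepKernelFamily (flipK flipK_apply)
open KernelWard (Bdd)
open KernelReflection (LegMap refK refK_apply bondRefl tadpole_smul)
open Summit.QuantumFields.BalabanUV.Beta.D1BFx.GhostStencil (ghCur ghCur_apply ghCur_translate biLoc_ghCur)
open Summit.QuantumFields.BalabanUV.Beta.D1BFx.ReducedKernelSandwichBlock (diagExt diagExt_apply)
open Summit.QuantumFields.BalabanUV.Beta.D1BFx.GhostStencilReflection (ghX)
open Summit.QuantumFields.BalabanUV.Beta.FP.PerfectPolarization (Pker G0ker PiBF PiBF_def Pker_translate G0ker_translate G0ker_apply)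
open Summit.QuantumFields.BalabanUV.Beta.FP.PerfectPolarizationWard (bdd_Pker bdd_G0ker)
open Summit.QuantumFields.BalabanUV.Beta.FP.PerfectPolarizationReflection (axisReflectionCovariant_lincomb)
open Summit.QuantumFields.BalabanUV.Beta.FP.PerfectPropagatorReflection (exists_legMap_refK_G0ker)
open Summit.QuantumFields.BalabanUV.Beta.FP.HessKerReflectionSplit (axisReflectionCovariant_flip_hessKer_one_of_tadpoleKer axisReflectionCovariant_flip_tadpoleKer_of_bondDiagonal)
open Summit.QuantumFields.BalabanUV.Beta.FP.GhostJetReflection (ghCur_bondRefl)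

/-! ## §1 The tadpole word of a diagonal extension is reflection covariant -/

/-- [folklore] off the diagonal bond a diagonal extension vanishes. -/
theorem diagExt_of_neg {G : Type*} (T : Fin 4 → Site 4 → MKer 4 G) {μ ν : Fin 4} {y y' : Site 4} (h : ¬(μ = ν ∧ y = y')) :
    diagExt T μ y ν y' = 0 := by
  unfold diagExt
  rw [if_neg h]

/-- [folklore] **THE TADPOLE WORD OF ANY BOND-DIAGONAL EXTENSION IS REFLECTION COVARIANT** over ANY scalar leg:
`AxisReflectionCovariant (fun μ ν z => tadpole A (diagExt T μ 0 ν (−z)))` (R3a's `axisReflectionCovariant_flip_tadpoleKer_of_bondDiagonal`). -/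
theorem axisReflectionCovariant_flip_tadpoleKer_diagExt (A : MKer 4 Unit) (T : Fin 4 → Site 4 → MKer 4 Unit) :
    AxisReflectionCovariant (fun μ ν z => tadpole A (diagExt T μ 0 ν (-z))) :=
  axisReflectionCovariant_flip_tadpoleKer_of_bondDiagonal A fun _ _ _ _ h => diagExt_of_neg T h

/-! ## §2 The ghost sector at the admissible cross contact: reflection covariant, no letter left -/

/-- [our object] **THE GHOST-SECTOR RESOLVENT HESSIAN KERNEL AT `(cV • ghCur, diagExt (c • ghX))` IS REFLECTION COVARIANT, UNCONDITIONALLY** (every real `cV c`):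
leaf-02 g9's `GhostJetReflection.axisReflectionCovariant_flip_hessKer_ghost` with the head-contact family `Wgh cW` replaced by the cross-contact extension — same proof
(`bdd_G0ker`, `G0ker_translate`, `biLoc_ghCur`, `ghCur_translate`, `ghCur_bondRefl` against R2 layer b's `G0ker`-invariant relabelling, tadpole word §1, assembled by R3 layer a). -/
theorem axisReflectionCovariant_flip_hessKer_ghostX (cV c : ℝ) :
    AxisReflectionCovariant (fun μ ν z => hessKer G0ker (fun μ y => cV • ghCur μ y) (diagExt (fun κ u => c • ghX κ u)) μ ν (-z)) := by
  have hV : ∀ (μ : Fin 4) (y : Site 4), BiLoc ((fun μ y => cV • ghCur μ y) μ y) y y (|cV| * Real.exp 1) 1 := by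
    intro μ y x z a b
    show |cV * ghCur μ y x z a b| ≤ |cV| * Real.exp 1 * Real.exp (-1 * (B12Sec2to5.l1 (x - y) + B12Sec2to5.l1 (z - y)))
    rw [abs_mul, mul_assoc]
    exact mul_le_mul_of_nonneg_left (biLoc_ghCur μ y 1 x z a b) (abs_nonneg cV)
  have hcov : ∀ (μ : Fin 4) (y t : Site 4), (fun μ y => cV • ghCur μ y) μ (y + t) = shiftK (-t) ((fun μ y => cV • ghCur μ y) μ y) := by
    intro μ y t
    show cV • ghCur μ (y + t) = shiftK (-t) (cV • ghCur μ y)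
    rw [ghCur_translate]
    rfl
  have hrefl : ∀ α : Fin 4, ∃ Ψα : LegMap 4 Unit, refK Ψα G0ker = G0ker ∧ ∃ c' : ℤ,
      ∀ μ y, (fun μ y => cV • ghCur μ y) μ (bondRefl α c' μ y) = reflSign α μ • refK Ψα ((fun μ y => cV • ghCur μ y) μ y) := by
    intro α
    obtain ⟨Ψ, hG, hr, -⟩ := exists_legMap_refK_G0ker α 0
    refine ⟨Ψ, hG, 0, fun μ y => ?_⟩
    show cV • ghCur μ (bondRefl α 0 μ y) = reflSign α μ • refK Ψ (cV • ghCur μ y)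
    have h := ghCur_bondRefl α μ 0 Ψ hr y
    rw [neg_zero] at h
    have hsm : refK Ψ (cV • ghCur μ y) = cV • refK Ψ (ghCur μ y) := by
      funext x' z' a b
      simp only [refK_apply, Pi.smul_apply, smul_eq_mul]
      ring
    rw [h, hsm, smul_comm]
  exact axisReflectionCovariant_flip_hessKer_one_of_tadpoleKer bdd_G0ker G0ker_translate hV hcov one_pos hrefl
    (axisReflectionCovariant_flip_tadpoleKer_diagExt G0ker fun κ u => c • ghX κ u)

/-- [our object] **(Kcov) FOR `PiBF` WITH THE GHOST SECTOR AT THE ADMISSIBLE CROSS CONTACT — GLUON LETTERS ONLY**: for gluon data `(V, W)` bi-localised at the unit-lattice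
bonds and translation covariant, with the first-order bond-reflection law against a `Pker`-invariant relabelling (every axis) and the gluon tadpole word reflection covariant,
`AxisReflectionCovariant (flipK (PiBF wg wgh V W (fun μ y => cV • ghCur μ y) (diagExt (fun κ u => c • ghX κ u))))` for every `wg wgh cV c` — VERBATIM the hypothesis list of
leaf-02 g9's `GhostJetReflection.axisReflectionCovariant_flipK_PiBF_ghostTyped`; at `(cV, c) = (1, −1)` this is the `hKcov` binder of road FP's ENDs with the ghost block of
`GhostBiTableLaw.ghost_sector_letters`. -/
theorem axisReflectionCovariant_flipK_PiBF_ghostX (wg wgh cV c : ℝ)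
    {V : Fin 4 → Site 4 → MKer 4 (Fib 3)} {W : Fin 4 → Site 4 → Fin 4 → Site 4 → MKer 4 (Fib 3)} {Cv δ : ℝ} (hδ : 0 < δ)
    (hV : ∀ (μ : Fin 4) (y : Site 4), BiLoc (V μ y) y y Cv δ) (hcovV : ∀ (μ : Fin 4) (y t : Site 4), V μ (y + t) = shiftK (-t) (V μ y))
    (hreflV : ∀ α : Fin 4, ∃ Φα : LegMap 4 (Fib 3), refK Φα Pker = Pker ∧ ∃ c' : ℤ, ∀ μ y, V μ (bondRefl α c' μ y) = reflSign α μ • refK Φα (V μ y))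
    (htadP : AxisReflectionCovariant (fun μ ν z => tadpole Pker (W μ 0 ν (-z)))) :
    AxisReflectionCovariant (flipK (PiBF wg wgh V W (fun μ y => cV • ghCur μ y) (diagExt (fun κ u => c • ghX κ u)))) := by
  have h1 := axisReflectionCovariant_flip_hessKer_one_of_tadpoleKer bdd_Pker Pker_translate hV hcovV hδ hreflV htadP
  have h2 := axisReflectionCovariant_flip_hessKer_ghostX cV c
  have h := axisReflectionCovariant_lincomb h1 h2 wg wgh
  intro α μ ν z
  have h' := h α μ ν z
  simp only [flipK_apply, PiBF_def] at h' ⊢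
  exact h'

end Summit.QuantumFields.BalabanUV.Beta.FP.GhostBiTableReflection

end
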